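import Literature.AlgebraicGeometry.HodgeTheory.WeilFamilyKAction
import Literature.AlgebraicGeometry.HodgeTheory.InvariantClassesFromTotalSpaceHolds
import Literature.AlgebraicGeometry.HodgeTheory.MotivatedClassesDeformationInputs
import HarnessLib

/-!
# The named fact `deligne1982_weilFamily_kAction` ⇒ the route item `DeligneWeilFamily` (stmt-HodgeConjecture-16866) — line `Sketch`, v20

Line `Sketch` of crux `HeckePrymAnchors` (item stmt-HodgeConjecture-14496, route HeckePrymWeil),
continuation lead c14. Companion of `Theorems/HeckePrymWeilHeckePrymAnchorsOfDeligneWeilFamily`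
(p127207: item ⇒ fact, by `σ := globalSection W`; hence item ⇒ crux). This file lands the
CONVERSE on the tree's carriers, so that the line's one registered stub (the item's statement,
skeleton v20) and the Literature debt-queue entries `deligne1982_weilFamily_kAction` /
`_globalAction` / `_levelStructure` are certified EQUIVALENT renderings of one printed
construction ([Deligne1982HodgeCycles], proof of Thm. 4.8, pp. 47–51): whichever is discharged
first closes the crux (`heckePrymAnchors_of_deligneWeilFamily`, `heckePrymAnchors_of_kAction`).

* `deligneWeilFamily_of_kAction` — fact ⇒ item: the total space `𝒳 ↪ ℙᴺ × S` is quasi-projective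
  (`IsQuasiProjectiveOver.of_isClosedImmersion_projectiveSpace_tensor`), so the continuous section
  `σ` through `e^{-1*}c` is, at `s₁`, the restriction of ONE global class `W` by the tree's
  DISCHARGED invariant-cycle theorem `deligne1968_invariantClass_fromTotalSpace_holds`
  (Deligne 1968 / [VoisinHodgeII2003] Thm. 4.18 for smooth projective families immersed in `ℙᵐ`);
  every other clause is carried over verbatim.
Together with p127207's `kAction_of_deligneWeilFamily` this is the equivalence item ⇔ fact.
No `sorry`, no definition, no new axiom.
-/

noncomputable section

-- every declaration of this problem lives in `Summit.HodgeConjecture.HodgeConjecture.…` (summit = sub-problem)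
set_option linter.dupNamespace false

open CategoryTheory AlgebraicGeometry Limits MonoidalCategory CartesianMonoidalCategory

namespace Summit.HodgeConjecture.HodgeConjecture.Theorems.HeckePrymWeilLine

open Literature.AlgebraicGeometry Literature.AlgebraicGeometry.Motives Literature.AlgebraicGeometry.HodgeTheory

/-- **The named fact `deligne1982_weilFamily_kAction` implies the route item `DeligneWeilFamily`
(stmt-HodgeConjecture-16866).** The global class `W` with `W|_{s₁} = e^{-1*}c` is supplied by the
discharged invariant-cycle theorem `deligne1968_invariantClass_fromTotalSpace_holds` applied to the
fact's continuous section `σ` (the total space is quasi-projective as a closed subscheme of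
`ℙᴺ × S`); all other clauses verbatim.
[cite: Deligne1982HodgeCycles, proof of Thm. 4.8 (pp. 47–51), "Γ ⊂ SU" p. 50]
[cite: VoisinHodgeII2003, Thm. 4.18 (with Thm. 4.15, Lemma 4.17)] -/
theorem deligneWeilFamily_of_kAction :
    (Literature.AlgebraicGeometry.HodgeTheory.deligne1982_weilFamily_kAction) →
    (∀ p : ℕ, p.Prime → p % 4 = 3 → 7 ≤ p → ∀ (k : ℕ), 1 ≤ k → ∀ (X :
      Literature.AlgebraicGeometry.Motives.AbelianVariety ℂ) (Φ : X ⟶ X), X.dim = 2 * k →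
      CategoryTheory.CategoryStruct.comp Φ Φ = -((p : ℤ) • CategoryTheory.CategoryStruct.id X) → ∀ c
      : Literature.AlgebraicGeometry.HodgeTheory.complexBetti X.X (2 * k), c ∈
      Literature.AlgebraicGeometry.HodgeTheory.weilClassesOf X Φ k p → c ≠ 0 →
      Literature.AlgebraicGeometry.HodgeTheory.IsRationalClass c →
      Literature.AlgebraicGeometry.HodgeTheory.IsOfHodgeType (2 * k) X.X (2 * k) k k c → ∃ (𝒳 S :
      Literature.AlgebraicGeometry.Motives.SchemeOver ℂ) (f : 𝒳 ⟶ S) (g : 𝒳 ⟶ 𝒳) (s₁ s₀ :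
      Literature.AlgebraicGeometry.Motives.ComplexPoints S) (e : X.X ≅
      Literature.AlgebraicGeometry.Motives.fiberOver f s₁) (W :
      Literature.AlgebraicGeometry.HodgeTheory.complexBetti 𝒳 (2 * k)),
      Literature.AlgebraicGeometry.Motives.IsSmoothProjectiveFamily f (2 * k) ∧ (∃ (N : ℕ) (ι : 𝒳 ⟶
      CategoryTheory.MonoidalCategoryStruct.tensorObj
      (Literature.AlgebraicGeometry.Motives.projectiveSpace N ℂ) S),
      AlgebraicGeometry.IsClosedImmersion ι.left ∧ CategoryTheory.CategoryStruct.comp ι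
      (CategoryTheory.SemiCartesianMonoidalCategory.snd
      (Literature.AlgebraicGeometry.Motives.projectiveSpace N ℂ) S) = f) ∧ IrreducibleSpace S.left ∧
      AlgebraicGeometry.Smooth S.hom ∧ (∃ (P : Literature.AlgebraicGeometry.Motives.SchemeOver ℂ) (j
      : S ⟶ P), Literature.AlgebraicGeometry.Motives.IsProjectiveOver P ∧
      AlgebraicGeometry.IsOpenImmersion j.left) ∧ CategoryTheory.CategoryStruct.comp g f = f ∧ (∀ s
      : Literature.AlgebraicGeometry.Motives.ComplexPoints S, ∃ (A' :
      Literature.AlgebraicGeometry.Motives.AbelianVariety ℂ) (φ' : A' ⟶ A') (e' : A'.X ≅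
      Literature.AlgebraicGeometry.Motives.fiberOver f s), A'.dim = 2 * k ∧
      CategoryTheory.CategoryStruct.comp φ' φ' = -((p : ℤ) • CategoryTheory.CategoryStruct.id A') ∧
      CategoryTheory.CategoryStruct.comp (CategoryTheory.CategoryStruct.comp e'.hom
      (Literature.AlgebraicGeometry.Motives.fiberι f s)) g = CategoryTheory.CategoryStruct.comp
      φ'.hom.hom.hom (CategoryTheory.CategoryStruct.comp e'.hom
      (Literature.AlgebraicGeometry.Motives.fiberι f s))) ∧ CategoryTheory.CategoryStruct.comp
      (CategoryTheory.CategoryStruct.comp e.hom (Literature.AlgebraicGeometry.Motives.fiberι f s₁))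
      g = CategoryTheory.CategoryStruct.comp Φ.hom.hom.hom (CategoryTheory.CategoryStruct.comp e.hom
      (Literature.AlgebraicGeometry.Motives.fiberι f s₁)) ∧
      Literature.AlgebraicGeometry.HodgeTheory.complexBetti.map
      (Literature.AlgebraicGeometry.Motives.fiberι f s₁) (2 * k) W =
      Literature.AlgebraicGeometry.HodgeTheory.complexBetti.map e.inv (2 * k) c ∧ ∃ (Y :
      Literature.AlgebraicGeometry.Motives.AbelianVariety ℂ) (Ψ : Y ⟶ Y) (e₀ : Y.X ≅
      Literature.AlgebraicGeometry.Motives.fiberOver f s₀), (∃ (A₁ :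
      Literature.AlgebraicGeometry.Motives.AbelianVariety ℂ) (f₁ : Y ⟶ A₁.prod A₁) (g₁ : A₁.prod A₁
      ⟶ Y) (m : ℕ), A₁.dim = k ∧ Y.dim = 2 * k ∧ CategoryTheory.CategoryStruct.comp Ψ Ψ = -((p : ℤ)
      • CategoryTheory.CategoryStruct.id Y) ∧ 0 < m ∧ CategoryTheory.CategoryStruct.comp f₁ g₁ = m •
      CategoryTheory.CategoryStruct.id Y ∧ AlgebraicGeometry.Flat f₁.hom.hom.hom.left ∧
      CategoryTheory.CategoryStruct.comp g₁ Ψ = CategoryTheory.CategoryStruct.comp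
      (Literature.AlgebraicGeometry.Motives.AbelianVariety.prodLift
      (CategoryTheory.CategoryStruct.comp (Literature.AlgebraicGeometry.Motives.AbelianVariety.snd
      A₁ A₁) (-((p : ℤ) • CategoryTheory.CategoryStruct.id A₁)))
      (Literature.AlgebraicGeometry.Motives.AbelianVariety.fst A₁ A₁)) g₁) ∧
      CategoryTheory.CategoryStruct.comp (CategoryTheory.CategoryStruct.comp e₀.hom
      (Literature.AlgebraicGeometry.Motives.fiberι f s₀)) g = CategoryTheory.CategoryStruct.comp
      Ψ.hom.hom.hom (CategoryTheory.CategoryStruct.comp e₀.hom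
      (Literature.AlgebraicGeometry.Motives.fiberι f s₀))) := by
  intro h p hp hp4 hp7 k hk X Φ hX hΦ c hc hc0 hrat hH
  obtain ⟨𝒳, S, f, g, s₁, s₀, e, σ, hfam, hemb, hirr, hsm, hSqp, hg, hfib, he, hσ, hpt, hσ₁, Y, Ψ,
    e₀, hiso, he₀⟩ := h p hp hp4 hp7 k hk X Φ hX hΦ c hc hc0 hrat hH
  obtain ⟨N, ι, hι, hιf⟩ := hemb
  haveI := hι
  have h𝒳qp : IsQuasiProjectiveOver 𝒳 :=
    IsQuasiProjectiveOver.of_isClosedImmersion_projectiveSpace_tensor ι hSqp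
  -- the global class through the flat section (Deligne 1968, discharged in the tree)
  obtain ⟨W, hW⟩ := deligne1968_invariantClass_fromTotalSpace_holds 𝒳 S f (2 * k) hfam h𝒳qp hSqp
    hsm (2 * k) σ hσ hpt s₁
  refine ⟨𝒳, S, f, g, s₁, s₀, e, W, hfam, ⟨N, ι, hι, hιf⟩, hirr, hsm, hSqp, hg, hfib, he, ?_, Y, Ψ,
    e₀, hiso, he₀⟩
  -- `σ s₁ = ⟨s₁, e^{-1*}c⟩` and `σ s₁ = ⟨s₁, W|_{𝒳_{s₁}}⟩`
  have key : (⟨s₁, complexBetti.map e.inv (2 * k) c⟩ : FiberClass f (2 * k)) =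
      ⟨s₁, complexBetti.map (fiberι f s₁) (2 * k) W⟩ := hσ₁.symm.trans hW
  simp only [FiberClass.mk.injEq, heq_eq_eq, true_and] at key
  exact key.symm

end Summit.HodgeConjecture.HodgeConjecture.Theorems.HeckePrymWeilLine

end
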